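import Literature.Analysis.Matrix.FiniteRangeDecompositionPowSymbol
import Literature.Analysis.Matrix.FiniteRangeDecompositionVolumeUniform
import Literature.Analysis.Matrix.FiniteRangeDifferences
import HarnessLib

/-!
# Finite-range decomposition with smoother pieces, III: volume-uniform GRADIENT bounds in three
# dimensions

The quantitative content of [cite: Bauerschmidt2013, Thm. 1.2 / (1.10)] ("`|∇^α C_j(x,y)| ≤
C_α L^{−(d−2+|α|)(j−1)}`") for the power-`m` dyadic Fejér decomposition
(`FiniteRangeDecompositionPow.lean`, `…PowSymbol.lean`) on a three-dimensional discrete torus,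
UNIFORMLY IN THE VOLUME: in the abstract torus setting of
`FiniteRangeDecompositionVolumeUniform.lean` (a finite abelian group `G`, three steps `e₀,e₁,e₂` of
orders dividing `L₀,L₁,L₂` which determine the characters, `|G| ≥ L₀L₁L₂`, a translation-invariant
symmetric `A` with `c₀·Σ_i(2 − 2Re ψ(e_i)) ≤ σ_A(ψ)` and `A ≤ 4`), for every list `l` of `k` steps
among `±e_i` with `k ≤ 2m − 2` and every scale `2^N ≤ L_i`:

  `|G|⁻¹ Σ_ψ (Π_{g∈l} ‖ψ(g) − 1‖) σ_{C^{(m)}_N}(ψ) ≤ K(m,k,c₀) · 2^{−N(k+1)}`    (`avg_gradSymbol_frdPiecePow_le`),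
  `|∇_{g₁}⋯∇_{g_k} C^{(m)}_N (x,y)| ≤ K(m,k,c₀) · 2^{−N(k+1)}`                 (`abs_rowDiffs_frdPiecePow_apply_le_inv_pow`),

`K(m,k,c₀) = (27m(2π)^k/4)·(1 + 2^{k+4}π^{2m+2}/(16c₀)^{m+1})` — each lattice derivative gains exactly
one factor `2^{−N}`, the scaling `L^{−(d−2+|α|)j}` of a single momentum shell in `d = 3`.

Proof: the dyadic-shell argument of the `|α| = 0` file with two changes — the gradient factors are
bounded by the momentum, `‖ψ(±e_i) − 1‖ = 2|sin(πt_i)| ≤ 2π|t|_∞` (`prod_norm_addChar_sub_one_le`,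
`FiniteRangeDifferences.lean`),
and the symbol of the power-`m` piece decays like `a^{−(m+1)}` above its shell
(`symbol_frdPiecePow_re_mul_pow_le`), so that the sum over the ultraviolet shells
`Σ_{j<N} 2^{j(k+1−2m)}` converges geometrically exactly when `k ≤ 2m − 2`.  All [folklore].
-/

noncomputable section

open Finset Real
open Literature.Analysis.Fourier Literature.Analysis.Fourier.TrigApprox


namespace Literature.Analysis.Matrix

variable {G : Type*} [AddCommGroup G] [Fintype G] [DecidableEq G]

section Shells

variable {A : _root_.Matrix G G ℝ}

omit [Fintype G] [DecidableEq G] [AddCommGroup G] in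
/-- `4^N = (2^N)²`. [folklore] -/
private theorem four_pow_eq' (N : ℕ) : (4 : ℝ) ^ N = (2 ^ N) ^ 2 := by
  rw [show (4 : ℝ) = 2 ^ 2 by norm_num, ← pow_mul, mul_comm, pow_mul]

omit [Fintype G] [DecidableEq G] [AddCommGroup G] in
/-- `4^{Nm} = (2^N)^{2m}`. [folklore] -/
private theorem four_pow_mul_eq (N m : ℕ) : (4 : ℝ) ^ (N * m) = ((2 : ℝ) ^ N) ^ (2 * m) := by
  rw [pow_mul, four_pow_eq', ← pow_mul]

/-! ### Pointwise domination by the cube/shell indicator sums -/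

/-- **Pointwise domination** of the gradient-weighted symbol of a power-`m` piece by the cube/shell
indicator sums. [folklore] -/
theorem gradSymbol_frdPiecePow_le_shells
    (e : Fin 3 → G) (Ls : Fin 3 → ℕ) (hL : ∀ i, Ls i ≠ 0) (he : ∀ i, Ls i • e i = 0)
    (hA : IsTranslationInvariant A) (hs : A.IsHermitian) (h0 : A.PosSemidef)
    (h4 : ((4 : ℝ) • (1 : _root_.Matrix G G ℝ) - A).PosSemidef)
    {c₀ : ℝ} (hc₀ : 0 < c₀)
    (hcoer : ∀ ψ : AddChar G ℂ, c₀ * ∑ i, (2 - 2 * (ψ (e i)).re) ≤ (symbol A ψ).re)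
    (m N : ℕ) (ψ : AddChar G ℂ) (l : List G) (hl : ∀ g ∈ l, ∃ i, g = e i ∨ g = -e i) :
    (l.map fun g => ‖ψ g - 1‖).prod * (symbol (frdPiecePow A m N) ψ).re
      ≤ (2 * π / 2 ^ N) ^ l.length * (m * ((2 : ℝ) ^ N) ^ 2 / 4)
          * (if ∀ i, |addCharMomentum (Ls i) (e i) ψ| < 1 / 2 ^ N then (1 : ℝ) else 0)
        + ∑ j ∈ Finset.range N, (2 * π * 2 ^ (j + 1) / 2 ^ N) ^ l.length
            * (m * π ^ (2 * m + 2) / (4 * ((2 : ℝ) ^ N) ^ (2 * m))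
              * (((2 : ℝ) ^ N) ^ 2 / (16 * c₀ * ((2 : ℝ) ^ j) ^ 2)) ^ (m + 1))
            * (if ∀ i, |addCharMomentum (Ls i) (e i) ψ| < 2 ^ (j + 1) / 2 ^ N then (1 : ℝ) else 0) := by
  set T : ℝ := 2 ^ N with hT
  have hTpos : 0 < T := by positivity
  set t : Fin 3 → ℝ := fun i => addCharMomentum (Ls i) (e i) ψ with ht
  set s := (symbol (frdPiecePow A m N) ψ).re with hsdef
  set a := (symbol A ψ).re with hadef
  set k := l.length with hk
  set P := (l.map fun g => ‖ψ g - 1‖).prod with hPdef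
  set Y : ℝ := m * π ^ (2 * m + 2) / (4 * T ^ (2 * m)) with hYdef
  have hY0 : 0 ≤ Y := by rw [hYdef]; positivity
  have hP0 : 0 ≤ P := List.prod_nonneg fun x hx => by
    obtain ⟨g', -, rfl⟩ := List.mem_map.mp hx
    exact norm_nonneg _
  have hs0 : 0 ≤ s := symbol_frdPiecePow_re_nonneg ψ hA hs h0 h4 m N
  have hsX : s ≤ m * T ^ 2 / 4 := by
    have := symbol_frdPiecePow_re_le ψ hA hs h0 h4 m N
    rwa [four_pow_eq'] at this
  have hsY : s * a ^ (m + 1) ≤ Y := by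
    have := symbol_frdPiecePow_re_mul_pow_le ψ hA hs h0 h4 m N
    rwa [four_pow_mul_eq] at this
  -- nonnegativity of the shell terms
  have hB0 : ∀ j, 0 ≤ (2 * π * 2 ^ (j + 1) / T) ^ k
      * (Y * (T ^ 2 / (16 * c₀ * ((2 : ℝ) ^ j) ^ 2)) ^ (m + 1))
      * (if ∀ i, |t i| < 2 ^ (j + 1) / T then (1 : ℝ) else 0) := by
    intro j
    apply mul_nonneg (by positivity)
    split_ifs <;> norm_num
  have hsum0 : 0 ≤ ∑ j ∈ Finset.range N, (2 * π * 2 ^ (j + 1) / T) ^ k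
      * (Y * (T ^ 2 / (16 * c₀ * ((2 : ℝ) ^ j) ^ 2)) ^ (m + 1))
      * (if ∀ i, |t i| < 2 ^ (j + 1) / T then (1 : ℝ) else 0) :=
    Finset.sum_nonneg fun j _ => hB0 j
  by_cases hcube : ∀ i, |t i| < 1 / T
  · rw [if_pos hcube, mul_one]
    have hPc : P ≤ (2 * π / T) ^ k := by
      have := prod_norm_addChar_sub_one_le e Ls hL he ψ (fun i => (hcube i).le) l hl
      rwa [show 2 * π * (1 / T) = 2 * π / T by ring] at this
    have h1 : P * s ≤ (2 * π / T) ^ k * (m * T ^ 2 / 4) := mul_le_mul hPc hsX hs0 (by positivity)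
    linarith
  -- outside the small cube: locate the dyadic shell of `u = max_i |t_i|`
  rw [if_neg hcube, mul_zero, zero_add]
  obtain ⟨i₁, hi₁⟩ : ∃ i, 1 / T ≤ |t i| := by
    by_contra hcon
    exact hcube fun i => lt_of_not_ge fun h => hcon ⟨i, h⟩
  obtain ⟨i₀, -, hi₀⟩ := Finset.exists_max_image Finset.univ (fun i => |t i|) Finset.univ_nonempty
  set u := |t i₀| with hu
  have hi₀' : ∀ i, |t i| ≤ u := fun i => hi₀ i (Finset.mem_univ i)
  have hτu : 1 / T ≤ u := hi₁.trans (hi₀' i₁)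
  have hu_half : u ≤ 1 / 2 := abs_addCharMomentum_le (hL i₀) (he i₀) ψ
  have hTu1 : 1 ≤ T * u := by rw [div_le_iff₀ hTpos] at hτu; linarith
  set n₀ := ⌊T * u⌋₊ with hn₀
  have hn₀1 : 1 ≤ n₀ := Nat.le_floor (by exact_mod_cast hTu1)
  have hn₀le : (n₀ : ℝ) ≤ T * u := Nat.floor_le (by positivity)
  have hn₀lt : T * u < n₀ + 1 := Nat.lt_floor_add_one _
  set j := Nat.log 2 n₀ with hj
  have hj1 : 2 ^ j ≤ n₀ := Nat.pow_log_le_self 2 (by omega)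
  have hj2 : n₀ < 2 ^ (j + 1) := Nat.lt_pow_succ_log_self (by norm_num) n₀
  have hj1r : (2 : ℝ) ^ j ≤ T * u := le_trans (by exact_mod_cast hj1) hn₀le
  have hj2r : T * u < (2 : ℝ) ^ (j + 1) := by
    have : ((n₀ : ℝ) + 1) ≤ (2 : ℝ) ^ (j + 1) := by exact_mod_cast hj2
    linarith
  have hjN : j < N := by
    have h1 : (2 : ℝ) ^ j < 2 ^ N := by
      calc (2 : ℝ) ^ j ≤ T * u := hj1r
        _ ≤ T * (1 / 2) := by gcongr
        _ < T := by linarith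
        _ = 2 ^ N := hT
    exact (pow_lt_pow_iff_right₀ (by norm_num : (1 : ℝ) < 2)).mp h1
  have hushell : u < 2 ^ (j + 1) / T := by
    rw [lt_div_iff₀ hTpos]; linarith
  have hind : (∀ i, |t i| < 2 ^ (j + 1) / T) := fun i => (hi₀' i).trans_lt hushell
  -- the lower bound on `a`
  have ha : 16 * c₀ * (2 ^ j) ^ 2 / T ^ 2 ≤ a := by
    have h1 : 16 * u ^ 2 ≤ 2 - 2 * (ψ (e i₀)).re := by
      have := sixteen_mul_sq_le (hL i₀) (he i₀) ψ
      rw [hu, sq_abs]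
      exact this
    have h2 : 2 - 2 * (ψ (e i₀)).re ≤ ∑ i, (2 - 2 * (ψ (e i)).re) :=
      Finset.single_le_sum (fun i _ => two_sub_two_re_nonneg (hL i) (he i) ψ) (Finset.mem_univ i₀)
    have h3 := hcoer ψ
    have hu2 : (2 ^ j) ^ 2 / T ^ 2 ≤ u ^ 2 := by
      rw [div_le_iff₀ (by positivity)]
      calc ((2 : ℝ) ^ j) ^ 2 ≤ (T * u) ^ 2 := by gcongr
        _ = u ^ 2 * T ^ 2 := by ring
    calc 16 * c₀ * (2 ^ j) ^ 2 / T ^ 2 = c₀ * (16 * ((2 ^ j) ^ 2 / T ^ 2)) := by ring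
      _ ≤ c₀ * (16 * u ^ 2) := by gcongr
      _ ≤ c₀ * (2 - 2 * (ψ (e i₀)).re) := by gcongr
      _ ≤ c₀ * ∑ i, (2 - 2 * (ψ (e i)).re) := by gcongr
      _ ≤ a := h3
  have hlow : 0 < 16 * c₀ * (2 ^ j) ^ 2 / T ^ 2 := by positivity
  have hapos : 0 < a := hlow.trans_le ha
  -- `s ≤ Y · (T²/(16 c₀ 4^j))^{m+1}`
  have hsB : s ≤ Y * (T ^ 2 / (16 * c₀ * ((2 : ℝ) ^ j) ^ 2)) ^ (m + 1) := by
    have h1 : s ≤ Y / a ^ (m + 1) := by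
      rw [le_div_iff₀ (by positivity)]; exact hsY
    have h2 : Y / a ^ (m + 1) ≤ Y / (16 * c₀ * (2 ^ j) ^ 2 / T ^ 2) ^ (m + 1) := by
      gcongr
    have h3 : Y / (16 * c₀ * (2 ^ j) ^ 2 / T ^ 2) ^ (m + 1)
        = Y * (T ^ 2 / (16 * c₀ * ((2 : ℝ) ^ j) ^ 2)) ^ (m + 1) := by
      rw [div_eq_mul_inv, ← inv_pow, inv_div]
    linarith
  -- the gradient factor on the shell
  have hPj : P ≤ (2 * π * 2 ^ (j + 1) / T) ^ k := by
    have := prod_norm_addChar_sub_one_le e Ls hL he ψ hi₀' l hl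
    refine this.trans ?_
    rw [show 2 * π * 2 ^ (j + 1) / T = 2 * π * (2 ^ (j + 1) / T) by ring]
    gcongr
  -- the `j`-th term of the shell sum already dominates `P·s`
  have hmem : j ∈ Finset.range N := Finset.mem_range.mpr hjN
  calc P * s ≤ (2 * π * 2 ^ (j + 1) / T) ^ k * (Y * (T ^ 2 / (16 * c₀ * ((2 : ℝ) ^ j) ^ 2)) ^ (m + 1)) :=
        mul_le_mul hPj hsB hs0 (by positivity)
    _ = (2 * π * 2 ^ (j + 1) / T) ^ k * (Y * (T ^ 2 / (16 * c₀ * ((2 : ℝ) ^ j) ^ 2)) ^ (m + 1))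
        * (if ∀ i, |t i| < 2 ^ (j + 1) / T then (1 : ℝ) else 0) := by rw [if_pos hind, mul_one]
    _ ≤ ∑ j ∈ Finset.range N, (2 * π * 2 ^ (j + 1) / T) ^ k
        * (Y * (T ^ 2 / (16 * c₀ * ((2 : ℝ) ^ j) ^ 2)) ^ (m + 1))
        * (if ∀ i, |t i| < 2 ^ (j + 1) / T then (1 : ℝ) else 0) :=
      Finset.single_le_sum (fun j _ => hB0 j) hmem

/-! ### The arithmetic of one ultraviolet shell -/

omit [Fintype G] [DecidableEq G] [AddCommGroup G] in
/-- The `j`-th ultraviolet shell term: for `k + 2 ≤ 2m`,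
`(2π2^{j+1}/T)^k · (mπ^{2m+2}/(4T^{2m})) · (T²/(16c₀4^j))^{m+1} · (3·2^{j+1}/T)³
 ≤ (27m(2π)^kπ^{2m+2}2^{k+3}/(4(16c₀)^{m+1})) · (1/2)^j / T^{k+1}`. [folklore] -/
theorem shellTerm_le {c₀ T : ℝ} (hc₀ : 0 < c₀) (hT : 0 < T) {m k : ℕ} (hkm : k + 2 ≤ 2 * m) (j : ℕ) :
    (2 * π * 2 ^ (j + 1) / T) ^ k
        * (m * π ^ (2 * m + 2) / (4 * T ^ (2 * m)) * (T ^ 2 / (16 * c₀ * ((2 : ℝ) ^ j) ^ 2)) ^ (m + 1))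
        * (3 * (2 ^ (j + 1) / T)) ^ 3
      ≤ 27 * m * (2 * π) ^ k * π ^ (2 * m + 2) * 2 ^ (k + 3) / (4 * (16 * c₀) ^ (m + 1))
          * (1 / 2) ^ j / T ^ (k + 1) := by
  set S : ℝ := 2 ^ j with hS
  have hS0 : 0 < S := by positivity
  have hS1 : 1 ≤ S := one_le_pow₀ (by norm_num)
  -- exact evaluation of the left side
  have hL : (2 * π * 2 ^ (j + 1) / T) ^ k
        * (m * π ^ (2 * m + 2) / (4 * T ^ (2 * m)) * (T ^ 2 / (16 * c₀ * S ^ 2)) ^ (m + 1))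
        * (3 * (2 ^ (j + 1) / T)) ^ 3
      = 27 * m * (2 * π) ^ k * π ^ (2 * m + 2) * 2 ^ (k + 3) / (4 * (16 * c₀) ^ (m + 1))
          * (S ^ (k + 1) / S ^ (2 * m)) / T ^ (k + 1) := by
    rw [show (2 : ℝ) ^ (j + 1) = 2 * S by rw [pow_succ, hS]; ring]
    have hTk : T ^ k ≠ 0 := pow_ne_zero _ hT.ne'
    have hT2m : T ^ (2 * m) ≠ 0 := pow_ne_zero _ hT.ne'
    have hS2m : S ^ (2 * m) ≠ 0 := pow_ne_zero _ hS0.ne'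
    have hSk : S ^ k ≠ 0 := pow_ne_zero _ hS0.ne'
    have hc16 : (16 : ℝ) ^ m ≠ 0 := pow_ne_zero _ (by norm_num)
    have hcm : c₀ ^ m ≠ 0 := pow_ne_zero _ hc₀.ne'
    simp only [div_pow, mul_pow]
    rw [show (T ^ 2) ^ (m + 1) = T ^ (2 * m) * T ^ 2 by ring,
      show (S ^ 2) ^ (m + 1) = S ^ (2 * m) * S ^ 2 by ring,
      show c₀ ^ (m + 1) = c₀ ^ m * c₀ by ring, show (16 : ℝ) ^ (m + 1) = 16 ^ m * 16 by ring,
      show (2 : ℝ) ^ (k + 3) = 2 ^ k * 8 by ring, show T ^ (k + 1) = T ^ k * T by ring]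
    field_simp
    ring
  -- `S^{k+1}/S^{2m} ≤ (1/2)^j`
  have hratio : S ^ (k + 1) / S ^ (2 * m) ≤ (1 / 2) ^ j := by
    rw [div_le_iff₀ (by positivity), one_div_pow, ← hS, div_mul_eq_mul_div, one_mul, le_div_iff₀ hS0,
      ← pow_succ]
    exact pow_le_pow_right₀ hS1 (by omega)
  rw [hL]
  have hC : 0 ≤ 27 * m * (2 * π) ^ k * π ^ (2 * m + 2) * 2 ^ (k + 3) / (4 * (16 * c₀) ^ (m + 1)) := by
    positivity
  have hTk : 0 < T ^ (k + 1) := by positivity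
  exact div_le_div_of_nonneg_right (mul_le_mul_of_nonneg_left hratio hC) hTk.le

/-! ### The volume-uniform gradient bound -/

/-- **The volume-uniform gradient-weighted single-shell bound in `d = 3`.**  Under the hypotheses of the
header, for every list `l` of `k ≤ 2m − 2` steps among `±e_i` and every scale with `2^N ≤ L_i`:
`|G|⁻¹ Σ_ψ (Π_{g∈l}‖ψ(g) − 1‖) σ_{C^{(m)}_N}(ψ) ≤ K(m,k,c₀)/2^{N(k+1)}` with
`K = (27m(2π)^k/4)(1 + 2^{k+4}π^{2m+2}/(16c₀)^{m+1})`.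
[cite: Bauerschmidt2013, (1.10) (the bound for `|α| = k`, `d = 3`)] -/
theorem avg_gradSymbol_frdPiecePow_le
    (e : Fin 3 → G) (Ls : Fin 3 → ℕ) (he : ∀ i, Ls i • e i = 0)
    (hgen : ∀ ψ φ : AddChar G ℂ, (∀ i, ψ (e i) = φ (e i)) → ψ = φ)
    (hcard : ∏ i, (Ls i : ℝ) ≤ Fintype.card G)
    (hA : IsTranslationInvariant A) (hs : A.IsHermitian) (h0 : A.PosSemidef)
    (h4 : ((4 : ℝ) • (1 : _root_.Matrix G G ℝ) - A).PosSemidef)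
    {c₀ : ℝ} (hc₀ : 0 < c₀)
    (hcoer : ∀ ψ : AddChar G ℂ, c₀ * ∑ i, (2 - 2 * (ψ (e i)).re) ≤ (symbol A ψ).re)
    (m N : ℕ) (hLN : ∀ i, 2 ^ N ≤ Ls i)
    (l : List G) (hl : ∀ g ∈ l, ∃ i, g = e i ∨ g = -e i) (hkm : l.length + 2 ≤ 2 * m) :
    (Fintype.card G : ℝ)⁻¹ * ∑ ψ : AddChar G ℂ,
        (l.map fun g => ‖ψ g - 1‖).prod * (symbol (frdPiecePow A m N) ψ).re
      ≤ 27 * m * (2 * π) ^ l.length / 4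
          * (1 + 2 ^ (l.length + 4) * π ^ (2 * m + 2) / (16 * c₀) ^ (m + 1))
          / ((2 : ℝ) ^ N) ^ (l.length + 1) := by
  set T : ℝ := 2 ^ N with hT
  set k := l.length with hk
  have hTpos : 0 < T := by positivity
  have hL : ∀ i, Ls i ≠ 0 := fun i => by
    have := hLN i; have := Nat.one_le_two_pow (n := N); omega
  have hLr : ∀ i, (0 : ℝ) < Ls i := fun i => Nat.cast_pos.mpr (Nat.pos_of_ne_zero (hL i))
  have hLT : ∀ i, T ≤ Ls i := fun i => by rw [hT]; exact_mod_cast hLN i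
  have hcardpos : (0 : ℝ) < Fintype.card G := Nat.cast_pos.mpr Fintype.card_pos
  -- abbreviations
  set c0 : ℝ := ((Finset.univ.filter fun ψ : AddChar G ℂ =>
      ∀ i, |addCharMomentum (Ls i) (e i) ψ| < 1 / T).card : ℝ) with hc0def
  set cj : ℕ → ℝ := fun j => ((Finset.univ.filter fun ψ : AddChar G ℂ =>
      ∀ i, |addCharMomentum (Ls i) (e i) ψ| < 2 ^ (j + 1) / T).card : ℝ) with hcjdef
  set X0 : ℝ := (2 * π / T) ^ k * (m * T ^ 2 / 4) with hX0def
  set B : ℕ → ℝ := fun j => (2 * π * 2 ^ (j + 1) / T) ^ k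
      * (m * π ^ (2 * m + 2) / (4 * T ^ (2 * m)) * (T ^ 2 / (16 * c₀ * ((2 : ℝ) ^ j) ^ 2)) ^ (m + 1))
    with hBdef
  have hB0 : ∀ j, 0 ≤ B j := fun j => by rw [hBdef]; positivity
  have hX00 : 0 ≤ X0 := by rw [hX0def]; positivity
  -- Step 1: pointwise domination, summed over `ψ`
  have hpt := fun ψ => gradSymbol_frdPiecePow_le_shells e Ls hL he hA hs h0 h4 hc₀ hcoer m N ψ l hl
  have hsum : ∑ ψ : AddChar G ℂ, (l.map fun g => ‖ψ g - 1‖).prod * (symbol (frdPiecePow A m N) ψ).re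
      ≤ X0 * c0 + ∑ j ∈ Finset.range N, B j * cj j := by
    refine (Finset.sum_le_sum fun ψ _ => hpt ψ).trans (le_of_eq ?_)
    rw [Finset.sum_add_distrib, ← Finset.mul_sum, Finset.sum_boole, Finset.sum_comm]
    congr 1
    refine Finset.sum_congr rfl fun j _ => ?_
    rw [← Finset.mul_sum, Finset.sum_boole]
  -- Step 2: counts, divided by the volume
  have hc0 : (Fintype.card G : ℝ)⁻¹ * c0 ≤ (3 * (1 / T)) ^ 3 := by
    have h1 := card_filter_momentum_lt_le e Ls hL he hgen (show (0 : ℝ) < 1 / T by positivity)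
    calc (Fintype.card G : ℝ)⁻¹ * c0
        ≤ (Fintype.card G : ℝ)⁻¹ * ∏ i, (2 * (Ls i : ℝ) * (1 / T) + 1) := by gcongr
      _ ≤ ∏ i, (2 * (1 / T) + 1 / (Ls i : ℝ)) := inv_card_mul_prod_le hLr hcard (by positivity)
      _ ≤ (3 * (1 / T)) ^ 3 := prod_two_mul_add_inv_le hTpos hLT le_rfl
  have hcj : ∀ j, (Fintype.card G : ℝ)⁻¹ * cj j ≤ (3 * (2 ^ (j + 1) / T)) ^ 3 := by
    intro j
    have h1 := card_filter_momentum_lt_le e Ls hL he hgen (show (0 : ℝ) < 2 ^ (j + 1) / T by positivity)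
    calc (Fintype.card G : ℝ)⁻¹ * cj j
        ≤ (Fintype.card G : ℝ)⁻¹ * ∏ i, (2 * (Ls i : ℝ) * (2 ^ (j + 1) / T) + 1) := by gcongr
      _ ≤ ∏ i, (2 * (2 ^ (j + 1) / T) + 1 / (Ls i : ℝ)) := inv_card_mul_prod_le hLr hcard (by positivity)
      _ ≤ (3 * (2 ^ (j + 1) / T)) ^ 3 := by
          refine prod_two_mul_add_inv_le hTpos hLT ?_
          gcongr
          exact one_le_pow₀ (by norm_num)
  -- Step 3: the arithmetic of each term
  set C₁ : ℝ := 27 * m * (2 * π) ^ k * π ^ (2 * m + 2) * 2 ^ (k + 3) / (4 * (16 * c₀) ^ (m + 1)) with hC₁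
  have hC₁0 : 0 ≤ C₁ := by rw [hC₁]; positivity
  have hterm0 : X0 * ((Fintype.card G : ℝ)⁻¹ * c0) ≤ 27 * m * (2 * π) ^ k / 4 / T ^ (k + 1) := by
    calc X0 * ((Fintype.card G : ℝ)⁻¹ * c0) ≤ X0 * (3 * (1 / T)) ^ 3 :=
          mul_le_mul_of_nonneg_left hc0 hX00
      _ = 27 * m * (2 * π) ^ k / 4 / T ^ (k + 1) := by
          have hTk : T ^ k ≠ 0 := pow_ne_zero _ hTpos.ne'
          rw [hX0def, div_pow, show T ^ (k + 1) = T ^ k * T by ring]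
          field_simp
          ring
  have htermj : ∀ j, B j * ((Fintype.card G : ℝ)⁻¹ * cj j) ≤ C₁ * (1 / 2) ^ j / T ^ (k + 1) := by
    intro j
    calc B j * ((Fintype.card G : ℝ)⁻¹ * cj j) ≤ B j * (3 * (2 ^ (j + 1) / T)) ^ 3 :=
          mul_le_mul_of_nonneg_left (hcj j) (hB0 j)
      _ ≤ C₁ * (1 / 2) ^ j / T ^ (k + 1) := by
          rw [hBdef, hC₁]
          exact shellTerm_le hc₀ hTpos hkm j
  -- Step 4: assemble
  calc (Fintype.card G : ℝ)⁻¹ * ∑ ψ : AddChar G ℂ,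
          (l.map fun g => ‖ψ g - 1‖).prod * (symbol (frdPiecePow A m N) ψ).re
      ≤ (Fintype.card G : ℝ)⁻¹ * (X0 * c0 + ∑ j ∈ Finset.range N, B j * cj j) := by gcongr
    _ = X0 * ((Fintype.card G : ℝ)⁻¹ * c0)
        + ∑ j ∈ Finset.range N, B j * ((Fintype.card G : ℝ)⁻¹ * cj j) := by
          rw [mul_add, Finset.mul_sum]
          congr 1
          · ring
          · exact Finset.sum_congr rfl fun j _ => by ring
    _ ≤ 27 * m * (2 * π) ^ k / 4 / T ^ (k + 1) + ∑ j ∈ Finset.range N, C₁ * (1 / 2) ^ j / T ^ (k + 1) :=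
          add_le_add hterm0 (Finset.sum_le_sum fun j _ => htermj j)
    _ = 27 * m * (2 * π) ^ k / 4 / T ^ (k + 1)
        + C₁ / T ^ (k + 1) * ∑ j ∈ Finset.range N, (1 / 2 : ℝ) ^ j := by
          rw [Finset.mul_sum]
          exact congrArg _ (Finset.sum_congr rfl fun j _ => by ring)
    _ ≤ 27 * m * (2 * π) ^ k / 4 / T ^ (k + 1) + C₁ / T ^ (k + 1) * 2 := by
          gcongr
          exact sum_geometric_two_le N
    _ = 27 * m * (2 * π) ^ k / 4 * (1 + 2 ^ (k + 4) * π ^ (2 * m + 2) / (16 * c₀) ^ (m + 1))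
        / T ^ (k + 1) := by
          rw [div_mul_eq_mul_div, ← add_div, hC₁, show (2 : ℝ) ^ (k + 4) = 2 ^ (k + 3) * 2 by ring]
          congr 1
          ring

/-- **Volume-uniform gradient kernel bound in `d = 3`**: for every list `l` of `k ≤ 2m − 2` steps among
`±e_i` and `2^N ≤ L_i`,
`|∇_{g₁}⋯∇_{g_k} C^{(m)}_N (x,y)| ≤ K(m,k,c₀) · 2^{−N(k+1)}` — each lattice derivative gains one factor
`2^{−N}`. [cite: Bauerschmidt2013, (1.10) (the case `|α| = k`, `d = 3`)] -/
theorem abs_rowDiffs_frdPiecePow_apply_le_inv_pow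
    (e : Fin 3 → G) (Ls : Fin 3 → ℕ) (he : ∀ i, Ls i • e i = 0)
    (hgen : ∀ ψ φ : AddChar G ℂ, (∀ i, ψ (e i) = φ (e i)) → ψ = φ)
    (hcard : ∏ i, (Ls i : ℝ) ≤ Fintype.card G)
    (hA : IsTranslationInvariant A) (hs : A.IsHermitian) (h0 : A.PosSemidef)
    (h4 : ((4 : ℝ) • (1 : _root_.Matrix G G ℝ) - A).PosSemidef)
    {c₀ : ℝ} (hc₀ : 0 < c₀)
    (hcoer : ∀ ψ : AddChar G ℂ, c₀ * ∑ i, (2 - 2 * (ψ (e i)).re) ≤ (symbol A ψ).re)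
    (m N : ℕ) (hLN : ∀ i, 2 ^ N ≤ Ls i)
    (l : List G) (hl : ∀ g ∈ l, ∃ i, g = e i ∨ g = -e i) (hkm : l.length + 2 ≤ 2 * m) (x y : G) :
    |rowDiffs l (frdPiecePow A m N) x y|
      ≤ 27 * m * (2 * π) ^ l.length / 4
          * (1 + 2 ^ (l.length + 4) * π ^ (2 * m + 2) / (16 * c₀) ^ (m + 1))
          / ((2 : ℝ) ^ N) ^ (l.length + 1) :=
  (abs_rowDiffs_frdPiecePow_apply_le hA hs h0 h4 m N l x y).trans
    (avg_gradSymbol_frdPiecePow_le e Ls he hgen hcard hA hs h0 h4 hc₀ hcoer m N hLN l hl hkm)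

/-- The `k = 0` case: **volume-uniform kernel bound for the power-`m` pieces**,
`|C^{(m)}_N(x,y)| ≤ (27m/4)(1 + 2⁴π^{2m+2}/(16c₀)^{m+1}) · 2^{−N}` for `m ≥ 1`, `2^N ≤ L_i`.
[cite: Bauerschmidt2013, (1.10) (the case `|α| = 0`, `d = 3`)] -/
theorem abs_frdPiecePow_apply_le_inv_two_pow
    (e : Fin 3 → G) (Ls : Fin 3 → ℕ) (he : ∀ i, Ls i • e i = 0)
    (hgen : ∀ ψ φ : AddChar G ℂ, (∀ i, ψ (e i) = φ (e i)) → ψ = φ)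
    (hcard : ∏ i, (Ls i : ℝ) ≤ Fintype.card G)
    (hA : IsTranslationInvariant A) (hs : A.IsHermitian) (h0 : A.PosSemidef)
    (h4 : ((4 : ℝ) • (1 : _root_.Matrix G G ℝ) - A).PosSemidef)
    {c₀ : ℝ} (hc₀ : 0 < c₀)
    (hcoer : ∀ ψ : AddChar G ℂ, c₀ * ∑ i, (2 - 2 * (ψ (e i)).re) ≤ (symbol A ψ).re)
    {m : ℕ} (hm : 1 ≤ m) (N : ℕ) (hLN : ∀ i, 2 ^ N ≤ Ls i) (x y : G) :
    |frdPiecePow A m N x y|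
      ≤ 27 * m / 4 * (1 + 2 ^ 4 * π ^ (2 * m + 2) / (16 * c₀) ^ (m + 1)) / 2 ^ N := by
  have h := abs_rowDiffs_frdPiecePow_apply_le_inv_pow e Ls he hgen hcard hA hs h0 h4 hc₀ hcoer m N hLN
    [] (fun g hg => by simp at hg) (by simp; omega) x y
  simpa using h

end Shells

end Literature.Analysis.Matrix

end
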